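import Summits.ResolutionOfSingularities.ResolutionOfSingularities.Theorems.TauChainCutCells2
import Summits.ResolutionOfSingularities.ResolutionOfSingularities.Theorems.HistoryCutCells
import Summits.ResolutionOfSingularities.ResolutionOfSingularities.Theorems.DepthCutCells
import Summits.ResolutionOfSingularities.ResolutionOfSingularities.Theorems.WallTowers
import Summits.ResolutionOfSingularities.ResolutionOfSingularities.Theorems.WallCutCells
import Summits.ResolutionOfSingularities.ResolutionOfSingularities.Theorems.SurfacePortCells
import Summits.ResolutionOfSingularities.ResolutionOfSingularities.Theorems.MarkedTransferCampaignW46ThreefoldsTauTwoSlice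
import Summits.ResolutionOfSingularities.ResolutionOfSingularities.Theorems.FrobeniusLadderFInjectiveMacaulayficationProp44Assembly
import Summits.ResolutionOfSingularities.ResolutionOfSingularities.Theorems.LatencyCutKernels
import Summits.ResolutionOfSingularities.ResolutionOfSingularities.Theorems.TameCutStage
import Summits.ResolutionOfSingularities.ResolutionOfSingularities.Theorems.TameCutKernels
import Literature.AlgebraicGeometry.Resolution.BlowupSNC
import Literature.AlgebraicGeometry.Resolution.HironakaTauScheme
import Literature.AlgebraicGeometry.Resolution.RegularSubschemeLocallyIrreducible
import Literature.AlgebraicGeometry.Resolution.NearChainTermination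
import Literature.AlgebraicGeometry.Resolution.NearPointTauMonotone
import Literature.AlgebraicGeometry.Resolution.NearPointsPointCentre
import Literature.AlgebraicGeometry.Resolution.AdaptedTauOneForms
import Literature.AlgebraicGeometry.Resolution.IsolatedOrderPoint
import Literature.AlgebraicGeometry.Resolution.Hironaka2005CompletionRegular
import Literature.AlgebraicGeometry.Resolution.RegularLocalRingsNormal
import Literature.AlgebraicGeometry.Hironaka2017.PermissibleLSB
import Literature.AlgebraicGeometry.Resolution.HypersurfaceMaxOrderTransform
import Literature.AlgebraicGeometry.Resolution.ControlledTransformBaseChange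
import Literature.AlgebraicGeometry.Resolution.Hironaka2005BasicFactsRegularEquiv
import Literature.AlgebraicGeometry.Resolution.RegularCentreBlowupOrder
import Literature.AlgebraicGeometry.Resolution.MarkedIdealsLemmas
import Literature.AlgebraicGeometry.Resolution.StalkIdealLemmas
import Literature.AlgebraicGeometry.Resolution.HypersurfaceTransform
import Literature.AlgebraicGeometry.Resolution.DifferentialOperators
import Literature.AlgebraicGeometry.Resolution.RegularLocalRingsProofs
import Literature.AlgebraicGeometry.Resolution.RegularLocalRingsQuotient
import Mathlib.Algebra.CharP.Lemmas
import HarnessLib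

/-!
# FactorCutKernels — decomp-res node «FactorCut» (lens-4 g33, critic row 191 CLEARED +1), tree file 1/5 of the node

Content VERBATIM from the decomp-res lens-4 g33 node `HOME/decomp-res-lens-4/g33/FactorCut.lean` (pin dd0f861c, 1607
l; HOME = run/shared/lean/pub/decomp-res), its NEW part §99–§104 (l. 859–1605) only: the node CARRIED g32
«TauChainCut» rev 2 l. 48–839 byte-identically (l. 62–857, between the `══ CARRY g32 rev 2` / `══ END CARRY`
markers) because g32 was not yet in the tree — that carry is DROPPED here and replaced by `import
…Theorems.TauChainCutCells2` (g32 landed as `TauChainLaw` / `TauChainLaw2` / `TauChainCutCells` /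
`TauChainCutCells2` / `MaxContactCutTauChainCut`); every declaration below is new, same namespace
`…Theorems.HugValuationCut`.  Farm (node, lens + critic runs): rc 0 · 0 err · 0 warn · 0 sorry · axioms std; Probe
rc 0 (30 must-fail sorries, 0 other).  Critic: CRITIC-LEDGER row 191 CLEARED +1 (lane (NP-b) of row 186: the MIXED
residual cut by the STALK FACTORIZATIONS of the marked ideal — forcing law (F), transport engine at the factor's own
weight, latent-factor kill; cells A/B decided, C the located residual, D attackable).  Landing orders = the critic
rider INBOX :1051 (= the lens NOTE INBOX :1049): (1) `FactorCutKernels` = §99–§102 (sections `FactorCalculus` /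
`FactorChains`), (2) `FactorCutCells` = §103–§104 (sections `FactorCells` / `OccultEntrances`), carry deleted,
imports = the landed TauChainCut files + the node header's cone-free imports; both VERBATIM, `--kind proof
--supports stmt-ResolutionOfSingularities-28338`; decl names final.  As for g26–g32 the `h71` corollaries of §103
(given 31571 `MaxContactCut.NoContactHuggingTowers` BY NAME, Theses cone) go to a third file
`MaxContactCutFactorCut` so that the cells file stays importable by the route.  The new `def … : Prop`
(`FactorAt`-letters, the four cells, the `NoWild*` names) are cells / letters of THIS node — none is a vendored
fact.  Aside bookkeeping (rider): exactly ONE live aside on the lens-4 column — the g33 residual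
`NoWildOccultMixedTowers` ≔ `NoWildOccultDivisorialMixedTowers ∧ NoWildOccultNonDivisorialMixedTowers` (writer-added
3-line def in `FactorCutCells`, per rider) SUPERSEDES the g31 aside
`NSNoWildNonSurfaceWallFreeFreshJumpShallowCompanionKangarooTowers` (item 28078) DIRECTLY (the intermediate g32
residual `NoWildMixedWallFreeFreshJumpShallowCompanionKangarooTowers` is landed but never filed as an aside, per the
critic: switch once); re-location theorems `noWildMixedWallFreeFreshJumpShallowCompanionKangarooTowers_iff_g33`
(hyp-free) and `noWildContactFreeOffLocusTowers_iff_g33 (h71) (h640)`.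

The lens header, verbatim:

> # FactorCut — decomp-res-lens-4 g33 node «FactorCut» (lane (NP-b) of CRITIC row 186: the mixed residual cut by the STALK
> FACTORIZATIONS of the marked ideal; see the module docstrings of §99–§104 and HOME/decomp-res-lens-4/g33/NODE-g33.md).
>
> CARRY: g32 «TauChainCut» rev 2 (HOME/decomp-res-lens-4/g32/TauChainCut_rev2.lean, sha256 d70c0cc0…, STATUS PIN
2026-08-31T05:48:58Z) is
> NOT yet in the tree; its l. 48–839 (§92–§98) are carried BYTE-IDENTICALLY below between the markers `══ CARRY g32 rev 2` and
> `══ END CARRY`; everything after `══ END CARRY` (§99–§104) is NEW in g33.  When g32 lands as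
`Theorems/TauChainCut*.lean` the carried
> block is deleted and replaced by the corresponding `import`s — nothing else changes.

## This file

§99 (NEW · KERNEL) STALK CALCULUS OF THE CONTROLLED TRANSFORM AND THE PRODUCT LAW (`section FactorCalculus`:
`idealOrder_congr_stalk`, stalks of controlled transforms, `controlledTransform_mul_of_le_idealOrder` …); §100 (NEW
· LETTER + KERNEL) STALK-LOCAL FACTORIZATIONS OF THE MARKED IDEAL AND THE FORCING LAW (`section FactorChains`: the
letter `FactorAt T i a b H K` — at the marked point the marked stalk FACTORS `𝓘 = H·K` with `ord H = a`, `ord K =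
b`, `FactorAt.add_eq`; `facIter`; THE FORCING LAW `FactorAt.forcing`: the factorization PERSISTS along the whole
tower with the SAME weights — any dimension, no principality / hypersurface hypothesis); §101 (NEW · KERNEL)
PRINCIPAL FACTORS: persistence, `strict = controlled` (`FactorAt.principal_facIter`), and THE HUGGING LAW; §102 (NEW
· KERNEL) THE GENERAL TRANSPORT ENGINE — Giraud's lemma along ANY ideal chain growing at least as fast as its
weight-`(N+1)` controlled transform — and THE LATENT-FACTOR KILL (`hugsGerm_of_chain_absCon…`,
`noTowerWild_latentFactor_threefold`) — continued in `FactorCutKernels2`… where the 400-line cap cuts.  (This first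
part carries: `idealOrder_congr_stalk`, `stalkIdeal_controlledTransform_eq`, `stalkIdeal_controlledTransform_congr`,
`controlledTransform_mul_of_le_idealOrder`, `isRegularLocalRing_quotient_of_dim_three`, `FactorAt`, `FactorAt.symm`,
`facIter`, `facIter_zero`, `facIter_succ`, `FactorAt.add_eq`, `FactorAt.forcing`.)

[WRITER NOTE (decomp-res writer g12): file split only (tree files ≤ 400 lines); namespace, sections, section
variables / universes / opens and every declaration exactly as in the lens (the carry block and the node's global
dupNamespace-linter line are dropped — the library sets the latter; the two namespace-level `open
…AbsoluteContactClasses` / `open …Hironaka2005 (…)` lines of the new part are replayed in every file; the `open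
…Theses` line and the lens's cone imports `MaxContactCutSatelliteCut` / `MaxContactCutWallCutCells` /
`MaxContactCutSurfacePort` live only in the Theses-cone file `MaxContactCutFactorCut`).]

(Sources: Hironaka1964 Ch. III; Giraud1975 (Giraud's lemma); Kollar2007 3.58–3.60; CossartJannsenSaito2020 Thm.
6.40, Def. 6.38–6.39, Ch. 8; Hauser2010Kangaroo; HauserPerlega2019 §2; CossartPiltant2008 §2; CossartPiltant2019;
Hironaka2005 (three key theorems); EGAIV4 §16; Matsumura1987 §28; StacksProject 0804 / 0BIQ / 031I.)
-/

noncomputable section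

open CategoryTheory AlgebraicGeometry IsLocalRing TopologicalSpace
open Literature.AlgebraicGeometry.Resolution
open Summit.ResolutionOfSingularities.ResolutionOfSingularities.Theorems
open WeakOrderReduction ForcedTowerClasses DivergentTowerClasses MonomialTowerClasses
open HugDimensionClasses HugDimensionKernels SurfaceShadowClasses SurfaceShadowKernels
open NearPointCut (SingularClass)
open Scheme.IdealSheafData (vanishingIdeal)
open scoped BigOperators

namespace Summit.ResolutionOfSingularities.ResolutionOfSingularities.Theorems.HugValuationCut

open Summit.ResolutionOfSingularities.ResolutionOfSingularities.Theorems.AbsoluteContactClasses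
  (IsAbsContactAt SepResidueAt AbsInv absInv_point sepResidueAt_of_perfectField)
open Literature.AlgebraicGeometry.Resolution.Hironaka2005 (le_idealOrder_of_mul_le le_idealOrder_of_mul_le')

section FactorCalculus

universe u
variable {X X' : Scheme.{u}} {π : X' ⟶ X}

/-! ## §99 (g33 · NEW · KERNEL) STALK CALCULUS OF THE CONTROLLED TRANSFORM AND THE PRODUCT LAW -/

/-- the order of an ideal sheaf at a point depends only on its stalk there. [folklore] -/
theorem idealOrder_congr_stalk {I I' : X.IdealSheafData} {x : X} (h : stalkIdeal I x = stalkIdeal I' x) :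
    idealOrder I x = idealOrder I' x := by
  refine ENat.eq_of_forall_natCast_le_iff fun n => ?_
  rw [le_idealOrder_iff, le_idealOrder_iff, h]

/-- **the stalk of a controlled transform** `(π⁻¹J : (π⁻¹C)^μ)` at `x'` is the colon of the extended stalk `J_{π x'}·𝒪_{x'}` by
the `μ`-th power of the exceptional stalk. [folklore] -/
theorem stalkIdeal_controlledTransform_eq [IsLocallyNoetherian X'] (C J : X.IdealSheafData) (μ : ℕ) (x' : X') :
    stalkIdeal (controlledTransform π C J μ) x' =
      Submodule.colon ((stalkIdeal J (π.base x')).map (π.stalkMap x').hom)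
        ((stalkIdeal (C.comap π) x' ^ μ : Ideal (X'.presheaf.stalk x')) : Set (X'.presheaf.stalk x')) := by
  rw [controlledTransform, stalkIdeal_colon, stalkIdeal_pow, stalkIdeal_comap_eq_map_stalkMap]

/-- **stalk congruence**: two ideal sheaves with the same stalk at `π x'` have controlled transforms with the same stalk at
`x'`. [folklore] -/
theorem stalkIdeal_controlledTransform_congr [IsLocallyNoetherian X'] (C : X.IdealSheafData) {J₁ J₂ : X.IdealSheafData}
    (μ : ℕ) {x' : X'}
    (h : stalkIdeal J₁ (π.base x') = stalkIdeal J₂ (π.base x')) :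
    stalkIdeal (controlledTransform π C J₁ μ) x' = stalkIdeal (controlledTransform π C J₂ μ) x' := by
  rw [stalkIdeal_controlledTransform_eq, stalkIdeal_controlledTransform_eq, h]

/-- **THE PRODUCT LAW OF CONTROLLED TRANSFORMS** (KERNEL): for the blow-up `π` of a regular centre `Y` of a regular scheme
and ideal sheaves `H, K` of orders `≥ a, ≥ b` along `Y`,
`(π⁻¹(HK) : E^{a+b}) = (π⁻¹H : E^a) · (π⁻¹K : E^b)` — because `E` is an effective Cartier divisor and
`E^a·(π⁻¹H : E^a) = π⁻¹H`, `E^b·(π⁻¹K : E^b) = π⁻¹K` (tree `pow_mul_controlledTransform_eq_of_forall_le_idealOrder`,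
`colon_pow_eq_of_mul_eq`). (Sources: Hironaka1964; Kollar2007, 3.58–3.60; EncinasVillamayor2000.) -/
theorem controlledTransform_mul_of_le_idealOrder [IsLocallyNoetherian X] [IsLocallyNoetherian X']
    (hX : Scheme.IsRegular X) {Y : Closeds X} (hreg : Scheme.IsRegular (vanishingIdeal Y).subscheme)
    (hπ : IsBlowup π (vanishingIdeal Y)) {H K : X.IdealSheafData} {a b : ℕ}
    (hH : ∀ y ∈ (Y : Set X), (a : ℕ∞) ≤ idealOrder H y) (hK : ∀ y ∈ (Y : Set X), (b : ℕ∞) ≤ idealOrder K y) :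
    controlledTransform π (vanishingIdeal Y) (H * K) (a + b) =
      controlledTransform π (vanishingIdeal Y) H a * controlledTransform π (vanishingIdeal Y) K b := by
  have eH := Literature.AlgebraicGeometry.Hironaka2017.pow_mul_controlledTransform_eq_of_forall_le_idealOrder
    hX hreg hπ hH
  have eK := Literature.AlgebraicGeometry.Hironaka2017.pow_mul_controlledTransform_eq_of_forall_le_idealOrder
    hX hreg hπ hK
  have hprod : (vanishingIdeal Y).comap π ^ (a + b) *
      (controlledTransform π (vanishingIdeal Y) H a * controlledTransform π (vanishingIdeal Y) K b) =
        (H * K).comap π := by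
    rw [comap_mul, ← eH, ← eK, pow_add, mul_mul_mul_comm]
  rw [controlledTransform]
  exact colon_pow_eq_of_mul_eq hπ.isEffectiveCartier hprod

/-- dimension bookkeeping: cutting a regular local ring of dimension `3` by an element of `𝔪 ∖ 𝔪²` leaves a regular local
ring of dimension `2`. (Sources: Matsumura1987, Thm. 14.2.) -/
theorem isRegularLocalRing_quotient_of_dim_three {R : Type*} [CommRing R] [IsRegularLocalRing R]
    (hR : ringKrullDim R = 3) {x : R} (hx : x ∈ maximalIdeal R) (hx2 : x ∉ maximalIdeal R ^ 2) :
    IsRegularLocalRing (R ⧸ Ideal.span {x}) ∧ ringKrullDim (R ⧸ Ideal.span {x}) = 2 := by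
  obtain ⟨hq, hdim⟩ := IsRegularLocalRing.quotient_span_singleton hx hx2
  haveI := hq
  obtain ⟨m, hm⟩ := exists_nat_cast_eq_ringKrullDim (R := R ⧸ Ideal.span {x})
  refine ⟨hq, ?_⟩
  rw [hm, hR] at hdim
  have h3 : m + 1 = 3 := by exact_mod_cast hdim
  have hm2 : m = 2 := by omega
  rw [hm, hm2]
  rfl

end FactorCalculus

section FactorChains

variable {k : Type} [Field k]

/-! ## §100 (g33 · NEW · LETTER + KERNEL) STALK-LOCAL FACTORIZATIONS OF THE MARKED IDEAL AND THE FORCING LAW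

`FactorAt T i a b H K`: at the marked point `x_i` the marked stalk FACTORS, `𝓘_{i,x_i} = H_{x_i} · K_{x_i}` with
`ord_{x_i} H = a`, `ord_{x_i} K = b` (so `a + b = n`, `FactorAt.add_eq`). THE FORCING LAW (`FactorAt.forcing`): the
factorization PERSISTS along the whole tower with the SAME weights — `𝓘_{i+j, x_{i+j}} = H_j · K_j` where
`H_j = (π⁻¹H_{j-1} : E^a)`, `K_j = (π⁻¹K_{j-1} : E^b)` are the weight-`a` / weight-`b` controlled transforms (`facIter`), and
`ord H_j = a`, `ord K_j = b` at every marked point: orders of controlled transforms in a point blow-up do not go up, and they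
cannot go down because they must still add up to `n = ord 𝓘_{i+j}` (orders add in a regular local ring). No principality,
no hypersurface hypothesis, any dimension. -/

/-- **LETTER `FactorAt T i a b H K`** (tower-intrinsic): the marked stalk at `x_i` is the product of the stalks of the ideal
sheaves `H` and `K` of stage `i`, of orders exactly `a` and `b` at `x_i`. -/
def FactorAt (T : ForcedTower) (i a b : ℕ) (H K : (T.St i).IdealSheafData) : Prop :=
  stalkIdeal (T.D i).ideal (T.pt i) = stalkIdeal H (T.pt i) * stalkIdeal K (T.pt i) ∧
    idealOrder H (T.pt i) = ((a : ℕ) : ℕ∞) ∧ idealOrder K (T.pt i) = ((b : ℕ) : ℕ∞)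

/-- factorizations are symmetric. [folklore] -/
theorem FactorAt.symm {T : ForcedTower} {i a b : ℕ} {H K : (T.St i).IdealSheafData} (h : FactorAt T i a b H K) :
    FactorAt T i b a K H :=
  ⟨h.1.trans (mul_comm _ _), h.2.2, h.2.1⟩

/-- **the factor chain** `facIter T m w F j`: the `j`-fold weight-`w` controlled transform of the ideal sheaf `F` of stage `m`
along the tower (`F ↦ (π⁻¹F : E^w)` at each step). -/
def facIter (T : ForcedTower) (m w : ℕ) (F : (T.St m).IdealSheafData) : (j : ℕ) → (T.St (m + j)).IdealSheafData
  | 0 => F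
  | j + 1 => controlledTransform (T.π (m + j)) (T.centre (m + j)) (facIter T m w F j) w

/-- [folklore] -/
theorem facIter_zero (T : ForcedTower) (m w : ℕ) (F : (T.St m).IdealSheafData) : facIter T m w F 0 = F := rfl

/-- [folklore] -/
theorem facIter_succ (T : ForcedTower) (m w : ℕ) (F : (T.St m).IdealSheafData) (j : ℕ) :
    facIter T m w F (j + 1) = controlledTransform (T.π (m + j)) (T.centre (m + j)) (facIter T m w F j) w := rfl

/-- **weights of a factorization add up to the marked weight**: `a + b = n` (orders add in the regular local ring
`𝒪_{x_i}`, tree `Ideal.mul_not_le_maximalIdeal_pow`; the marked order at `x_i` is `n`, tree `tower_idealOrder_pt_eq`).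
(Sources: Matsumura1987, Thm. 14.2; Hironaka2005, §2.) -/
theorem FactorAt.add_eq (T : ForcedTower) (g : T.St 0 ⟶ Spec (.of k)) (hB : IsBase (T.St 0) g) {n : ℕ}
    (hD : IsDatum n (T.D 0)) {i a b : ℕ} {H K : (T.St i).IdealSheafData} (h : FactorAt T i a b H K) : a + b = n := by
  haveI : IsRegularLocalRing ((T.St i).presheaf.stalk (T.pt i)) := (tower_isLocallyNoetherian_isRegular T g hB i).2 _
  have hn := tower_idealOrder_pt_eq T g hB hD i
  have h1 : ((a + b : ℕ) : ℕ∞) ≤ idealOrder (T.D i).ideal (T.pt i) := by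
    rw [le_idealOrder_iff, h.1, pow_add]
    exact Ideal.mul_mono ((le_idealOrder_iff H _ a).mp h.2.1.ge) ((le_idealOrder_iff K _ b).mp h.2.2.ge)
  have h2 : ¬ ((a + b + 1 : ℕ) : ℕ∞) ≤ idealOrder (T.D i).ideal (T.pt i) := by
    rw [le_idealOrder_iff, h.1]
    refine Hironaka2005.Ideal.mul_not_le_maximalIdeal_pow ?_ ?_
    · rw [← le_idealOrder_iff, h.2.1]
      exact fun hle => absurd (ENat.coe_le_coe.mp hle) (by omega)
    · rw [← le_idealOrder_iff, h.2.2]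
      exact fun hle => absurd (ENat.coe_le_coe.mp hle) (by omega)
  rw [hn] at h1 h2
  have h1' := ENat.coe_le_coe.mp h1
  have h2' : ¬ a + b + 1 ≤ n := fun hle => h2 (by exact_mod_cast hle)
  omega

/-- **THE FORCING LAW** (KERNEL, hypothesis-free): a stalk factorization `𝓘_{x_m} = H·K` with weights `(a, b)` persists at
EVERY later marked point with the same weights, the factors being the weight-`a` / weight-`b` controlled-transform chains
`facIter`. Proof: the stalk of the weight-`n` controlled transform depends only on the stalk downstairs (`stalkIdeal_colon`),
so it is the transform of `H_j K_j`, which is `(π⁻¹H_j : E^a)(π⁻¹K_j : E^b)` by the PRODUCT LAW; the orders of the two new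
factors are `≤ a`, `≤ b` (point blow-up, tree `IsBlowup.idealOrder_controlledTransform_le_of_mem`) and add up to at least
`n = a + b` (tree `le_idealOrder_of_mul_le`), so they are exactly `a` and `b`.
(Sources: Hironaka1964, Ch. III; Kollar2007, 3.58–3.60; CossartPiltant2008, Prop. 4.2.) -/
theorem FactorAt.forcing (T : ForcedTower) (g : T.St 0 ⟶ Spec (.of k)) (hB : IsBase (T.St 0) g) {n : ℕ}
    (hD : IsDatum n (T.D 0)) {m a b : ℕ} {H K : (T.St m).IdealSheafData} (hF : FactorAt T m a b H K) :
    ∀ j, FactorAt T (m + j) a b (facIter T m a H j) (facIter T m b K j) := by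
  have hab : a + b = n := hF.add_eq T g hB hD
  intro j
  induction j with
  | zero => exact hF
  | succ j ih =>
    show FactorAt T (m + j + 1) a b (facIter T m a H (j + 1)) (facIter T m b K (j + 1))
    obtain ⟨hNi, hRi⟩ := tower_isLocallyNoetherian_isRegular T g hB (m + j)
    obtain ⟨hNi1, hRi1⟩ := tower_isLocallyNoetherian_isRegular T g hB (m + j + 1)
    haveI := hNi
    haveI := hNi1
    haveI : IsRegularLocalRing ((T.St (m + j + 1)).presheaf.stalk (T.pt (m + j + 1))) := hRi1 _
    have hπ := tower_isBlowup_vanishingIdeal T (m + j)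
    have hreg : Scheme.IsRegular (vanishingIdeal ⟨{T.pt (m + j)}, T.isClosed_pt (m + j)⟩).subscheme := by
      rw [← tower_centre_eq_vanishingIdeal T (m + j)]
      exact T.centre_regular (m + j)
    have hx : (T.π (m + j)).base (T.pt (m + j + 1)) ∈
        ((⟨{T.pt (m + j)}, T.isClosed_pt (m + j)⟩ : Closeds (T.St (m + j))) : Set (T.St (m + j))) := by
      rw [T.pt_map]
      exact Set.mem_singleton _
    have hYH : ∀ y ∈ ((⟨{T.pt (m + j)}, T.isClosed_pt (m + j)⟩ : Closeds (T.St (m + j))) : Set (T.St (m + j))),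
        idealOrder (facIter T m a H j) y = a := by
      intro y hy
      have hy' : y = T.pt (m + j) := by simpa using hy
      rw [hy']
      exact ih.2.1
    have hYK : ∀ y ∈ ((⟨{T.pt (m + j)}, T.isClosed_pt (m + j)⟩ : Closeds (T.St (m + j))) : Set (T.St (m + j))),
        idealOrder (facIter T m b K j) y = b := by
      intro y hy
      have hy' : y = T.pt (m + j) := by simpa using hy
      rw [hy']
      exact ih.2.2
    have hst : stalkIdeal (T.D (m + j + 1)).ideal (T.pt (m + j + 1)) =
        stalkIdeal (facIter T m a H (j + 1) * facIter T m b K (j + 1)) (T.pt (m + j + 1)) := by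
      rw [tower_ideal_succ_eq_controlledTransform T hD (m + j),
        stalkIdeal_controlledTransform_congr _ n (J₂ := facIter T m a H j * facIter T m b K j)
          (by rw [T.pt_map, stalkIdeal_mul]; exact ih.1),
        ← hab, controlledTransform_mul_of_le_idealOrder hRi hreg hπ (fun y hy => (hYH y hy).ge)
          (fun y hy => (hYK y hy).ge),
        facIter_succ, facIter_succ, tower_centre_eq_vanishingIdeal]
    have hordI : idealOrder (facIter T m a H (j + 1) * facIter T m b K (j + 1)) (T.pt (m + j + 1)) = (n : ℕ∞) := by
      rw [← idealOrder_congr_stalk hst]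
      exact tower_idealOrder_pt_eq T g hB hD (m + j + 1)
    have hleH : idealOrder (facIter T m a H (j + 1)) (T.pt (m + j + 1)) ≤ a := by
      rw [facIter_succ, tower_centre_eq_vanishingIdeal]
      exact hπ.idealOrder_controlledTransform_le_of_mem hRi hreg hYH hx
    have hleK : idealOrder (facIter T m b K (j + 1)) (T.pt (m + j + 1)) ≤ b := by
      rw [facIter_succ, tower_centre_eq_vanishingIdeal]
      exact hπ.idealOrder_controlledTransform_le_of_mem hRi hreg hYK hx
    have hgeH : (a : ℕ∞) ≤ idealOrder (facIter T m a H (j + 1)) (T.pt (m + j + 1)) :=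
      le_idealOrder_of_mul_le ‹_› (by rw [hordI, ← hab]) hleK
    have hgeK : (b : ℕ∞) ≤ idealOrder (facIter T m b K (j + 1)) (T.pt (m + j + 1)) :=
      le_idealOrder_of_mul_le' ‹_› (by rw [hordI, ← hab]) hleH
    exact ⟨by rw [hst, stalkIdeal_mul], le_antisymm hleH hgeH, le_antisymm hleK hgeK⟩

end FactorChains

end Summit.ResolutionOfSingularities.ResolutionOfSingularities.Theorems.HugValuationCut
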